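import Mathlib
import Summits.PneNP.PneNP.Theorems.SfmBlSignAveraging

/-!
# Cylinder calculus, integer thresholds and the exchange of the `ê`-potential — line «sfm-bl»
(MACHINE-PLAN M4/M5: the SPEC of the `ê`-half of the potential and of the greedy step; PROOF-SFM-BL §3)

FRONTIER F-N1c; nothing here bears on P vs NP.

A CYLINDER is the set of signings `T : Fin m → Bool` agreeing with `T₀` on a set `P` of fixed outputs,
`cyl(P,T₀) = univ.filter (fun T => ∀ i ∈ P, T i = T₀ i)` (written out everywhere; definition-free file).
`χ = CandCutNorm.boolSign : Bool → ℤ` (`true ↦ −1`).  Companion file: `SfmBlCylinderDP` (the per-pair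
cylinder count by a forward dynamic programme).

* §A cylinder calculus: `card_cylinder` (`#cyl = 2^{#Pᶜ}`), `sum_cylinder_split` / `card_cylinder_split` (split
  on a free output — the recursion step of every evaluator and of the greedy loop), `sum_cylinder_univ`,
  determined sums (`signSum_eq_on_cylinder`, `card_cylinder_signSum_of_determined` — the leaves of a brute-force
  evaluator), and the PREFIX BRIDGES `filter_prefix_eq_cylinder` / `filter_prefix_flip_eq_cylinder` turning the
  two sides of the greedy hypothesis `hgreedy` of `SfmBl.cutCertified_of_greedy` into cylinders (so the M3/M4
  identities, stated for cylinders, apply to the M5 loop).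
* §B integer thresholds: `mul_sqrt_lt_abs_iff` — `γ√(ab) < |x| ↔ γ²ab < x²`; for `γ' = √(6000·2^60)` and an
  integer discrepancy `d`, `sfmBl_bad_iff_int : γ'√(ab) < |d| ↔ 6000·2^60·a·b < d²` in `ℤ` (the machine never
  takes a root), and `filter_bad_real_eq_int` (the bad-signing set of `SfmBlSpotBudget.card_badSignings_pair_le`
  in integer form, `d = Σ_j c_j χ(T j)` with the leg counts `c_j` of `SfmBl.pairSum_eq_sum_outputs`).
* §C exchange: `sum_sum_filter_eq_sum_mul_card` — `Σ_{T ∈ C} Σ_{W ∈ 𝒲, bad_T W} w W = Σ_{W ∈ 𝒲} w W · #{T ∈ C : bad_T W}`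
  (the `ê`-potential summed over a cylinder is a weighted sum of PER-PAIR CYLINDER COUNTS, each of which
  `SfmBlCylinderDP` computes exactly).
-/

namespace Summit.PneNP.PneNP.Theorems.SfmBl

open Finset BigOperators
open Summit.PneNP.PneNP.Theorems.CandCutNorm

variable {m : ℕ}

/-! ### §A Cylinder calculus -/

/-- `#cyl(P,T₀) = 2^{#Pᶜ}`. -/
theorem card_cylinder (P : Finset (Fin m)) (T₀ : Fin m → Bool) :
    (Finset.univ.filter fun T : Fin m → Bool => ∀ i ∈ P, T i = T₀ i).card = 2 ^ Pᶜ.card := by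
  have h := sum_filter_prod_boolSign_pow m (fun _ => 0) P T₀
  simp only [pow_zero, Finset.prod_const_one, one_mul, Finset.sum_const, nsmul_eq_mul, mul_one,
    Even.zero, if_true, Finset.prod_const] at h
  exact_mod_cast h

/-- Membership in a cylinder with one more fixed output. -/
theorem forall_insert_update_iff (P : Finset (Fin m)) {j : Fin m} (hj : j ∉ P) (T T₀ : Fin m → Bool)
    (b : Bool) :
    (∀ i ∈ insert j P, T i = Function.update T₀ j b i) ↔ (∀ i ∈ P, T i = T₀ i) ∧ T j = b := by
  rw [Finset.forall_mem_insert, Function.update_self, and_comm]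
  refine and_congr_left (fun _ => forall₂_congr fun i hi => ?_)
  rw [Function.update_of_ne (ne_of_mem_of_not_mem hi hj)]

/-- SPLITTING A CYLINDER ON A FREE OUTPUT `j ∉ P`:
`Σ_{cyl(P,T₀)} f = Σ_{cyl(P ∪ {j}, T₀[j ↦ false])} f + Σ_{cyl(P ∪ {j}, T₀[j ↦ true])} f`. -/
theorem sum_cylinder_split {M : Type*} [AddCommMonoid M] (f : (Fin m → Bool) → M)
    (P : Finset (Fin m)) (T₀ : Fin m → Bool) {j : Fin m} (hj : j ∉ P) :
    ∑ T ∈ Finset.univ.filter (fun T : Fin m → Bool => ∀ i ∈ P, T i = T₀ i), f T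
      = ∑ T ∈ Finset.univ.filter
            (fun T : Fin m → Bool => ∀ i ∈ insert j P, T i = Function.update T₀ j false i), f T
        + ∑ T ∈ Finset.univ.filter
            (fun T : Fin m → Bool => ∀ i ∈ insert j P, T i = Function.update T₀ j true i), f T := by
  rw [← Finset.sum_filter_add_sum_filter_not
    (Finset.univ.filter fun T : Fin m → Bool => ∀ i ∈ P, T i = T₀ i) (fun T => T j = false) f,
    Finset.filter_filter, Finset.filter_filter]
  congr 1
  · refine Finset.sum_congr (Finset.filter_congr fun T _ => ?_) fun _ _ => rfl
    rw [forall_insert_update_iff P hj]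
  · refine Finset.sum_congr (Finset.filter_congr fun T _ => ?_) fun _ _ => rfl
    rw [forall_insert_update_iff P hj, Bool.not_eq_false]

/-- Cardinality version of the split. -/
theorem card_cylinder_split (p : (Fin m → Bool) → Prop) [DecidablePred p]
    (P : Finset (Fin m)) (T₀ : Fin m → Bool) {j : Fin m} (hj : j ∉ P) :
    (Finset.univ.filter fun T : Fin m → Bool => (∀ i ∈ P, T i = T₀ i) ∧ p T).card
      = (Finset.univ.filter
            fun T : Fin m → Bool => (∀ i ∈ insert j P, T i = Function.update T₀ j false i) ∧ p T).card
        + (Finset.univ.filter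
            fun T : Fin m → Bool => (∀ i ∈ insert j P, T i = Function.update T₀ j true i) ∧ p T).card := by
  simp only [← Finset.filter_filter, Finset.card_filter]
  exact sum_cylinder_split _ P T₀ hj

/-- The full cylinder is a point. -/
theorem cylinder_univ (T₀ : Fin m → Bool) :
    (Finset.univ.filter fun T : Fin m → Bool => ∀ i ∈ (Finset.univ : Finset (Fin m)), T i = T₀ i)
      = {T₀} := by
  ext T
  simp only [Finset.mem_filter, Finset.mem_univ, true_and, forall_true_left, Finset.mem_singleton]
  exact ⟨fun h => funext h, fun h i => by rw [h]⟩

/-- `Σ_{cyl(univ,T₀)} f = f T₀`. -/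
theorem sum_cylinder_univ {M : Type*} [AddCommMonoid M] (f : (Fin m → Bool) → M) (T₀ : Fin m → Bool) :
    ∑ T ∈ Finset.univ.filter (fun T : Fin m → Bool => ∀ i ∈ (Finset.univ : Finset (Fin m)), T i = T₀ i),
      f T = f T₀ := by
  rw [cylinder_univ, Finset.sum_singleton]

/-- A signed sum whose coefficients vanish off `P` is constant on `cyl(P,T₀)`. -/
theorem signSum_eq_on_cylinder (c : Fin m → ℤ) (P : Finset (Fin m)) (T₀ T : Fin m → Bool)
    (hc : ∀ j, j ∉ P → c j = 0) (hT : ∀ i ∈ P, T i = T₀ i) :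
    ∑ j, c j * boolSign (T j) = ∑ j, c j * boolSign (T₀ j) := by
  refine Finset.sum_congr rfl fun j _ => ?_
  by_cases hj : j ∈ P
  · rw [hT j hj]
  · rw [hc j hj, zero_mul, zero_mul]

/-- DETERMINED CYLINDERS (the leaves of a brute-force evaluator): if all coefficients vanish off `P`, the
number of `T ∈ cyl(P,T₀)` with `p(Σ_j c_j χ(T j))` is `2^{#Pᶜ}·[p(Σ_j c_j χ(T₀ j))]`. -/
theorem card_cylinder_signSum_of_determined (c : Fin m → ℤ) (P : Finset (Fin m)) (T₀ : Fin m → Bool)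
    (hc : ∀ j, j ∉ P → c j = 0) (p : ℤ → Prop) [DecidablePred p] :
    (Finset.univ.filter
        fun T : Fin m → Bool => (∀ i ∈ P, T i = T₀ i) ∧ p (∑ j, c j * boolSign (T j))).card
      = if p (∑ j, c j * boolSign (T₀ j)) then 2 ^ Pᶜ.card else 0 := by
  by_cases hp : p (∑ j, c j * boolSign (T₀ j))
  · rw [if_pos hp, ← card_cylinder P T₀]
    congr 1
    refine Finset.filter_congr fun T _ => ⟨fun h => h.1, fun h => ⟨h, ?_⟩⟩
    rwa [signSum_eq_on_cylinder c P T₀ T hc h]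
  · rw [if_neg hp, Finset.card_eq_zero, Finset.filter_eq_empty_iff]
    rintro T - ⟨h1, h2⟩
    rw [signSum_eq_on_cylinder c P T₀ T hc h1] at h2
    exact hp h2

/-- PREFIX BRIDGE (1): the prefix class of `SfmBlCondExp` / `hgreedy` is the cylinder on `{i : i < k}`. -/
theorem filter_prefix_eq_cylinder (y : Fin m → Bool) (k : ℕ) :
    (Finset.univ.filter fun T : Fin m → Bool => ∀ i : Fin m, (i : ℕ) < k → T i = y i)
      = Finset.univ.filter fun T : Fin m → Bool =>
          ∀ i ∈ Finset.univ.filter (fun i : Fin m => (i : ℕ) < k), T i = y i := by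
  refine Finset.filter_congr fun T _ => ?_
  simp only [Finset.mem_filter, Finset.mem_univ, true_and]

/-- `a ≠ b ↔ a = !b` on `Bool`. -/
theorem bool_ne_iff_eq_not (a b : Bool) : a ≠ b ↔ a = !b := by
  cases a <;> cases b <;> decide

/-- PREFIX BRIDGE (2): the flipped branch `(∀ i < k, T i = y i) ∧ T k ≠ y k` of `hgreedy` is the cylinder on
`{i : i < k+1}` of the point `y[k ↦ ¬ y k]`. -/
theorem filter_prefix_flip_eq_cylinder (y : Fin m → Bool) (k : ℕ) (hk : k < m) :
    (Finset.univ.filter fun T : Fin m → Bool =>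
        (∀ i : Fin m, (i : ℕ) < k → T i = y i) ∧ T ⟨k, hk⟩ ≠ y ⟨k, hk⟩)
      = Finset.univ.filter fun T : Fin m → Bool =>
          ∀ i ∈ Finset.univ.filter (fun i : Fin m => (i : ℕ) < k + 1),
            T i = Function.update y ⟨k, hk⟩ (!y ⟨k, hk⟩) i := by
  refine Finset.filter_congr fun T _ => ?_
  simp only [Finset.mem_filter, Finset.mem_univ, true_and]
  constructor
  · rintro ⟨h1, h2⟩ i hi
    by_cases hik : i = ⟨k, hk⟩
    · subst hik
      rw [Function.update_self]
      exact (bool_ne_iff_eq_not _ _).1 h2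
    · rw [Function.update_of_ne hik]
      have : (i : ℕ) ≠ k := fun h => hik (Fin.ext h)
      exact h1 i (by omega)
  · intro h
    refine ⟨fun i hi => ?_, ?_⟩
    · have hik : i ≠ ⟨k, hk⟩ := fun e => by subst e; exact lt_irrefl _ hi
      rw [h i (by omega), Function.update_of_ne hik]
    · rw [bool_ne_iff_eq_not, h ⟨k, hk⟩ (by simp), Function.update_self]

/-! ### §B Integer thresholds (no square roots on the machine) -/

/-- `γ√(ab) < |x| ↔ γ²ab < x²` for `γ, a, b ≥ 0`. -/
theorem mul_sqrt_lt_abs_iff {γ a b : ℝ} (hγ : 0 ≤ γ) (ha : 0 ≤ a) (hb : 0 ≤ b) (x : ℝ) :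
    γ * Real.sqrt (a * b) < |x| ↔ γ ^ 2 * (a * b) < x ^ 2 := by
  have hγ' : γ = Real.sqrt (γ ^ 2) := (Real.sqrt_sq hγ).symm
  rw [hγ', ← Real.sqrt_mul (sq_nonneg γ), ← Real.sqrt_sq_eq_abs,
    Real.sqrt_lt_sqrt_iff (mul_nonneg (sq_nonneg γ) (mul_nonneg ha hb)), Real.sq_sqrt (sq_nonneg γ)]

/-- For `γ' = √(6000·2^60)` (`SfmBlNumerics`) and an INTEGER discrepancy `d`:
`γ'·√(ab) < |d| ↔ 6000·2^60·a·b < d²` in `ℤ`. -/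
theorem sfmBl_bad_iff_int (a b : ℕ) (d : ℤ) :
    Real.sqrt (6000 * 2 ^ 60) * Real.sqrt ((a : ℝ) * b) < |(d : ℝ)|
      ↔ (6000 * 2 ^ 60 * a * b : ℤ) < d ^ 2 := by
  rw [mul_sqrt_lt_abs_iff (Real.sqrt_nonneg _) (Nat.cast_nonneg a) (Nat.cast_nonneg b),
    Real.sq_sqrt (by positivity)]
  have e1 : (6000 * 2 ^ 60 * ((a : ℝ) * b) : ℝ) = ((6000 * 2 ^ 60 * a * b : ℤ) : ℝ) := by
    push_cast; ring
  have e2 : ((d : ℝ)) ^ 2 = ((d ^ 2 : ℤ) : ℝ) := by push_cast; ring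
  rw [e1, e2, Int.cast_lt]

/-- The bad-signing event of `SfmBlSpotBudget.card_badSignings_pair_le` in INTEGER FORM: for natural
coefficients `c_j` (leg counts) and sizes `a, b`,
`{T : γ'√(ab) < |Σ_j c_j χ(T j)|} = {T : 6000·2^60·a·b < (Σ_j c_j χ(T j))²}`. -/
theorem filter_bad_real_eq_int (c : Fin m → ℕ) (a b : ℕ) (C : Finset (Fin m → Bool)) :
    (C.filter fun T : Fin m → Bool =>
        Real.sqrt (6000 * 2 ^ 60) * Real.sqrt ((a : ℝ) * b)
          < |∑ j, (c j : ℝ) * ((boolSign (T j) : ℤ) : ℝ)|)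
      = C.filter fun T : Fin m → Bool =>
          (6000 * 2 ^ 60 * a * b : ℤ) < (∑ j, (c j : ℤ) * boolSign (T j)) ^ 2 := by
  refine Finset.filter_congr fun T _ => ?_
  have e : ∑ j, (c j : ℝ) * ((boolSign (T j) : ℤ) : ℝ) = ((∑ j, (c j : ℤ) * boolSign (T j) : ℤ) : ℝ) := by
    push_cast; rfl
  rw [e, sfmBl_bad_iff_int]

/-! ### §C Exchange: the `ê`-potential over a cylinder is a weighted sum of per-pair cylinder counts -/

/-- `Σ_{T ∈ C} Σ_{W ∈ 𝒲 : bad T W} w W = Σ_{W ∈ 𝒲} w W · #{T ∈ C : bad T W}`. -/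
theorem sum_sum_filter_eq_sum_mul_card {ι R : Type*} [CommSemiring R] (C : Finset (Fin m → Bool))
    (𝒲 : Finset ι) (w : ι → R) (bad : (Fin m → Bool) → ι → Prop) [∀ T W, Decidable (bad T W)] :
    ∑ T ∈ C, ∑ W ∈ 𝒲.filter (fun W => bad T W), w W
      = ∑ W ∈ 𝒲, w W * ((C.filter fun T => bad T W).card : R) := by
  simp_rw [Finset.sum_filter]
  rw [Finset.sum_comm]
  refine Finset.sum_congr rfl fun W _ => ?_
  rw [← Finset.sum_filter, Finset.sum_const, nsmul_eq_mul, mul_comm]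

end Summit.PneNP.PneNP.Theorems.SfmBl
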